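import Literature.NumberTheory.Weil1964.ArchPlaceCompactSliceCharacter
import Literature.NumberTheory.Weil1964.ArchFollandDualPairDefinitePlace
import HarnessLib

/-!
# The vacuum exponent of an adelic unitary dual pair at a DEFINITE place, on all test vectors that are the vacuum there

Topic `NumberTheory/Weil1964`; namespace `Literature.NumberTheory.Weil1964`.  KERNEL ONLY: one explicit definition
(`toUFormEquiv`, weil-2's frame homomorphism `toUForm` packaged as the isomorphism of topological groups it is) and
proved theorems; no record, no proof hole.  Continues `ArchFollandDualPairDefinitePlace` (the one-place form, on the
Gaussian, for a LOCAL datum `ω` of `U(P_v,Q_v) × U(R_v,S_v)`) and `ArchPlaceCompactSliceCharacter` (the several-places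
form for an abstract datum over `(piPhaseHom ε Φ).comp ϖ`).

Here the datum is over the ARCHIMEDEAN PAIR GROUP `G_∞ = U(J_V)(E ⊗ ℝ) × U(J_W)(E ⊗ ℝ)` of a hermitian dual pair over a
CM-type quadratic extension `E/F`, acting on `𝓢(ℝ^{ι × {v ∣ ∞ real}})` through the place-by-place phase homomorphism
`(piPhaseHom ε (v ↦ ι𝕎 (P v) (Q v) (R v) (S v))).comp ϖ` with `ϖ u v = archPairPlace v (u₁, u₂)` (weil-2's sign frames;
this is the phase homomorphism `archPairPhaseHom` of the Hodge-CM census kit, stated through the hypothesis `hϖ` so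
that no package-side name is needed), and the one-place subgroup is the section
`u ↦ (archSingle (wOf v) u, 1)`, `u ∈ U(σ_{w(v)} J_V)(ℂ)` (`UnitaryGroupArchSection`):

* §1 **`toUFormEquiv`** `: U(⋆, H)(ℂ) ≃ₜ* U(P,Q)` with `toUFormEquiv … k = toUForm … k` (`toUFormEquiv_apply`; so
  `det_coe_toUForm` of `ArchFollandDualPairDefinitePlace` applies verbatim);
* §2 `archPairPlace_archSingle_one_self/_of_ne` — the section placed in the frames: `(toUForm u, 1)` at `v`, `1` at
  the other real places (`archUForm_adelicSingle`, `archAt_archSingle_of_ne`; `wOf` is injective by `hover`);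
* §3 **`exists_forall_archSingle_binvPi_eq_det_zpow_smul`** — if `V` is definite at `v` (`IsEmpty (P v) ∨ IsEmpty (Q v)`):
  `∃ m : ℤ, ∀ u ∈ U(σ_{w(v)} J_V)(ℂ), ∀ G free of the place v, ω (archSingle (wOf v) u, 1) (B⁻¹G) = det(u)^m • B⁻¹G`
  (and the same on the Gaussian `h₀`) — `ArchPlaceCompactSliceCharacter` §4 along the continuous section
  `g ↦ (archSingle (wOf v) (toUFormEquiv⁻¹ g), 1)`;
* §4 **`exists_forall_archSingle_eq_det_zpow_smul_of_repTransport`** — the same read through `repTransport e ρ`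
  (`SchwartzCarrierTransport`): for a representation `ρ` on `𝓢(D)` and a real frame `e : D ≃L ℝ^{ι × {v real}}`,
  `ρ (archSingle (wOf v) u, 1) Φ = det(u)^m • Φ` for every `Φ` whose frame image `schwartzTransport e Φ = B⁻¹G` has `G`
  free of `v` — literally the currency of the census kit's `archWeilRep` / `cmArchWeilRep`.

Use (Hodge-CM model-construction cell, ticket D-5 (c5)/(S-norm), follow-on D-5e): with
`ω := repTransport e_D archWeilRep` (the census kit's (J-arch) datum `isArchWeilDatum_repTransport_archWeilRep_places`,
`hϖ` by `rfl`) this is the input of `GelbartRogawski1991/CompatibleSplittingTwistVacuumShift` at every definite place, for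
every test vector that is the vacuum at that place (any `K`-type polynomial at the other places).  Nothing here is a
claim of the manuscripts adjudicated by that cell.

References (conventions / provenance only): [PlatonovRapinchuk1994] V. Platonov, A. Rapinchuk, *Algebraic Groups and
Number Theory* (1994), §2.3; [BorelJacquet1979] A. Borel, H. Jacquet, Proc. Symp. Pure Math. 33.1 (1979), §4.1;
[Folland1989] G. B. Folland, *Harmonic Analysis in Phase Space* (1989), Prop. (4.39); [KonnoKonno2007] K. Konno,
T. Konno, Kyushu J. Math. 61 (2007), §3.1 (3.1).
-/

set_option autoImplicit false

noncomputable section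

open scoped Matrix Classical
open NumberField NumberField.InfinitePlace NumberField.mixedEmbedding SchwartzMap
open Literature.NumberTheory.Automorphic Literature.NumberTheory.Automorphic.UnitaryGroup
open Literature.RepresentationTheory.HeisenbergGroup Literature.Analysis.SegalBargmann
open Literature.RepresentationTheory.KonnoKonno2007 Literature.RepresentationTheory.KonnoKonno2007.RealDualPair

namespace Literature.NumberTheory.Weil1964

/-! ## §1 `toUForm` as an isomorphism of topological groups -/

section Equiv

variable {n : Type*} [Fintype n] [DecidableEq n] {P Q : Type*} [Fintype P] [DecidableEq P] [Fintype Q]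
  [DecidableEq Q]

/-- **`U(⋆, H)(ℂ) ≃ₜ* U(P,Q)`, `k ↦ (diag(D) k diag(D)⁻¹)^ε`** — weil-2's `toUForm` (conjugation by the Sylvester datum,
reindexing by the sign frame, `U(c • H₀) = U(H₀)`) packaged as the isomorphism of topological groups it is
(`unitaryGroupOfFormCongrOfEq`, `unitaryGroupOfFormReindex`, `ContinuousMulEquiv.restrictSubgroup`).
[cite: PlatonovRapinchuk1994, §2.3] -/
def toUFormEquiv (ε : n ≃ P ⊕ Q) {D : n → ℝ} (hD0 : ∀ j, D j ≠ 0) {c : ℝ} (hc : c ≠ 0) {H : Matrix n n ℂ}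
    (hH : formCongr (starRingEnd ℂ) (scaleGL D hD0) (((c : ℂ) • signForm P Q).submatrix ε ε) = H) :
    unitaryGroupOfForm (starRingEnd ℂ) H ≃ₜ* UForm P Q :=
  (unitaryGroupOfFormCongrOfEq (starRingEnd ℂ) (scaleGL D hD0) (((c : ℂ) • signForm P Q).submatrix ε ε) H hH).trans
    ((unitaryGroupOfFormReindex (starRingEnd ℂ) ε ((c : ℂ) • signForm P Q)).trans
      (ContinuousMulEquiv.restrictSubgroup (ContinuousMulEquiv.refl (GL (P ⊕ Q) ℂ))
        (unitaryGroupOfForm (starRingEnd ℂ) ((c : ℂ) • signForm P Q))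
        (unitaryGroupOfForm (starRingEnd ℂ) (signForm P Q)) fun g => by
          rw [unitaryGroupOfForm_smul_eq (signForm P Q) hc]
          rfl))

/-- `toUFormEquiv … k = toUForm … k`. [folklore] -/
@[simp] theorem toUFormEquiv_apply (ε : n ≃ P ⊕ Q) {D : n → ℝ} (hD0 : ∀ j, D j ≠ 0) {c : ℝ} (hc : c ≠ 0)
    {H : Matrix n n ℂ} (hH : formCongr (starRingEnd ℂ) (scaleGL D hD0) (((c : ℂ) • signForm P Q).submatrix ε ε) = H)
    (k : unitaryGroupOfForm (starRingEnd ℂ) H) : toUFormEquiv ε hD0 hc hH k = toUForm ε hD0 hc hH k :=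
  Subtype.ext rfl

/-- `toUFormEquiv` is continuous with continuous inverse (it is a `ContinuousMulEquiv`). [folklore] -/
theorem continuous_toUFormEquiv_symm (ε : n ≃ P ⊕ Q) {D : n → ℝ} (hD0 : ∀ j, D j ≠ 0) {c : ℝ} (hc : c ≠ 0)
    {H : Matrix n n ℂ}
    (hH : formCongr (starRingEnd ℂ) (scaleGL D hD0) (((c : ℂ) • signForm P Q).submatrix ε ε) = H) :
    Continuous (toUFormEquiv ε hD0 hc hH).symm :=
  (toUFormEquiv ε hD0 hc hH).symm.continuous

/-- `toUForm … (toUFormEquiv⁻¹ g) = g`. [folklore] -/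
theorem toUForm_toUFormEquiv_symm (ε : n ≃ P ⊕ Q) {D : n → ℝ} (hD0 : ∀ j, D j ≠ 0) {c : ℝ} (hc : c ≠ 0)
    {H : Matrix n n ℂ} (hH : formCongr (starRingEnd ℂ) (scaleGL D hD0) (((c : ℂ) • signForm P Q).submatrix ε ε) = H)
    (g : UForm P Q) : toUForm ε hD0 hc hH ((toUFormEquiv ε hD0 hc hH).symm g) = g := by
  rw [← toUFormEquiv_apply, ContinuousMulEquiv.apply_symm_apply]

end Equiv

/-! ## §2 The one-place section of the archimedean pair group, placed in the sign frames -/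

section WOf

variable {F : Type} [Field F] {E : Type} [Field E] [Algebra F E]

/-- `wOf` is injective: the real place under `wOf v` is `v`. [folklore] -/
theorem wOf_injective {wOf : {v : InfinitePlace F // v.IsReal} → {w : InfinitePlace E // w.IsComplex}}
    (hover : ∀ v, (wOf v).1.comap (algebraMap F E) = v.1) : Function.Injective wOf := fun v v' h =>
  Subtype.ext (by rw [← hover v, ← hover v', h])

end WOf

section Section

variable {F : Type} [Field F] [NumberField F] (E : Type) [Field E] [NumberField E] [Algebra F E] (c : E ≃ₐ[F] E)
variable (N M : ℕ) (hc : c ≠ 1)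
  (wOf : {v : InfinitePlace F // v.IsReal} → {w : InfinitePlace E // w.IsComplex})
  (hw : ∀ v, c • (wOf v).1 = (wOf v).1) (hover : ∀ v, (wOf v).1.comap (algebraMap F E) = v.1)
  (tV : Fin N → F) (tW : Fin M → F) {JV : Matrix (Fin N) (Fin N) E} {JW : Matrix (Fin M) (Fin M) E}
  (hJV : JV = (Matrix.diagonal tV).map (algebraMap F E)) (hJW : JW = (Matrix.diagonal tW).map (algebraMap F E))
  {P Q R S : {v : InfinitePlace F // v.IsReal} → Type*} [∀ v, Fintype (P v)] [∀ v, DecidableEq (P v)]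
  [∀ v, Fintype (Q v)] [∀ v, DecidableEq (Q v)] [∀ v, Fintype (R v)] [∀ v, DecidableEq (R v)]
  [∀ v, Fintype (S v)] [∀ v, DecidableEq (S v)]
  (εV : ∀ v, Fin N ≃ P v ⊕ Q v) (εW : ∀ v, Fin M ≃ R v ⊕ S v)
  {DV : {v : InfinitePlace F // v.IsReal} → Fin N → ℝ} {DW : {v : InfinitePlace F // v.IsReal} → Fin M → ℝ}
  (hDV0 : ∀ v i, DV v i ≠ 0) (hDW0 : ∀ v j, DW v j ≠ 0) {cV cW : {v : InfinitePlace F // v.IsReal} → ℝ}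
  (hcV : ∀ v, cV v ≠ 0) (hcW : ∀ v, cW v ≠ 0)
  (htV : ∀ v i, embedding_of_isReal v.2 (tV i) = cV v * signOf (εV v i) * DV v i ^ 2)
  (htW : ∀ v j, embedding_of_isReal v.2 (tW j) = cW v * signOf (εW v j) * DW v j ^ 2)
  (hfix : ∀ w : InfinitePlace E, c • w = w) (v : {v : InfinitePlace F // v.IsReal})

/-- **At its own place the section sits in the frame as `toUForm u`**:
`archPairPlace v (adelicSingle (wOf v) u, 1) = (toUForm … u, 1)`. [cite: BorelJacquet1979, §4.1] -/
theorem archPairPlace_adelicSingle_one_self (u : archLocal E N JV (wOf v)) :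
    archPairPlace E c N M hc wOf hw hover tV tW hJV hJW εV εW hDV0 hDW0 hcV hcW htV htW v
        (adelicSingle F E c N JV hc hfix (wOf v) u, 1) =
      ((toUForm (εV v) (hDV0 v) (hcV v) ((formCongr_scaleGL_smul_signForm (εV v) (hDV0 v) (cV v) (htV v)).trans
          (archLocalForm_diagonal E c N hc wOf hw hover tV hJV v).symm) u, 1) :
        Ginf (P v) (Q v) (R v) (S v)) := by
  rw [archPairPlace_adelicSingle_one, archUForm_adelicSingle]

/-- **At another real place `v' ≠ v` the section is `1`**: `archPairPlace v' (adelicSingle (wOf v) u, 1) = 1`.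
[cite: BorelJacquet1979, §4.1] -/
theorem archPairPlace_adelicSingle_one_of_ne {v' : {v : InfinitePlace F // v.IsReal}} (h : v' ≠ v)
    (u : archLocal E N JV (wOf v)) :
    archPairPlace E c N M hc wOf hw hover tV tW hJV hJW εV εW hDV0 hDW0 hcV hcW htV htW v'
        (adelicSingle F E c N JV hc hfix (wOf v) u, 1) = 1 := by
  have hne : wOf v' ≠ wOf v := fun h' => h (wOf_injective hover h')
  have h1 : archAt F E c N JV (wOf v') (hw v') hc (archPart F E c N JV (adelicSingle F E c N JV hc hfix (wOf v) u)) = 1 := by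
    rw [archPart_adelicSingle]
    exact archAt_archSingle_of_ne F E c N JV hc hfix (wOf v) hne u
  refine Prod.ext ?_ ?_
  · change archUForm E c N hc wOf hw hover tV hJV v' (εV v') (hDV0 v') (hcV v') (htV v')
        (adelicSingle F E c N JV hc hfix (wOf v) u) = 1
    exact (congrArg (toUForm (εV v') (hDV0 v') (hcV v')
      ((formCongr_scaleGL_smul_signForm (εV v') (hDV0 v') (cV v') (htV v')).trans
        (archLocalForm_diagonal E c N hc wOf hw hover tV hJV v').symm)) h1).trans (map_one _)
  · change archUForm E c M hc wOf hw hover tW hJW v' (εW v') (hDW0 v') (hcW v') (htW v') 1 = 1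
    exact map_one _

/-- the pair `((archSingle (wOf v) u)^adelic, 1^adelic)` is `(adelicSingle (wOf v) u, 1)`. [folklore] -/
theorem archToAdelic_archSingle_prod_one (u : archLocal E N JV (wOf v)) :
    ((UnitaryGroup.archToAdelic F E c N JV (archSingle F E c N JV hc hfix (wOf v) u),
        UnitaryGroup.archToAdelic F E c M JW 1) : UnitaryGroup.adelic F E c N JV × UnitaryGroup.adelic F E c M JW) =
      (adelicSingle F E c N JV hc hfix (wOf v) u, 1) :=
  Prod.ext rfl (map_one _)

/-- `archPairPlace v ((archSingle (wOf v) u)^adelic, 1^adelic) = (toUForm … u, 1)`. [cite: BorelJacquet1979, §4.1] -/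
theorem archPairPlace_archSingle_one_self (u : archLocal E N JV (wOf v)) :
    archPairPlace E c N M hc wOf hw hover tV tW hJV hJW εV εW hDV0 hDW0 hcV hcW htV htW v
        (UnitaryGroup.archToAdelic F E c N JV (archSingle F E c N JV hc hfix (wOf v) u),
          UnitaryGroup.archToAdelic F E c M JW 1) =
      ((toUForm (εV v) (hDV0 v) (hcV v) ((formCongr_scaleGL_smul_signForm (εV v) (hDV0 v) (cV v) (htV v)).trans
          (archLocalForm_diagonal E c N hc wOf hw hover tV hJV v).symm) u, 1) :
        Ginf (P v) (Q v) (R v) (S v)) :=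
  (congrArg (archPairPlace E c N M hc wOf hw hover tV tW hJV hJW εV εW hDV0 hDW0 hcV hcW htV htW v)
      (archToAdelic_archSingle_prod_one E c N M hc wOf hfix v u)).trans
    (archPairPlace_adelicSingle_one_self E c N M hc wOf hw hover tV tW hJV hJW εV εW hDV0 hDW0 hcV hcW htV htW hfix v u)

/-- `archPairPlace v' ((archSingle (wOf v) u)^adelic, 1^adelic) = 1` for `v' ≠ v`. [cite: BorelJacquet1979, §4.1] -/
theorem archPairPlace_archSingle_one_of_ne {v' : {v : InfinitePlace F // v.IsReal}} (h : v' ≠ v)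
    (u : archLocal E N JV (wOf v)) :
    archPairPlace E c N M hc wOf hw hover tV tW hJV hJW εV εW hDV0 hDW0 hcV hcW htV htW v'
        (UnitaryGroup.archToAdelic F E c N JV (archSingle F E c N JV hc hfix (wOf v) u),
          UnitaryGroup.archToAdelic F E c M JW 1) = 1 :=
  (congrArg (archPairPlace E c N M hc wOf hw hover tV tW hJV hJW εV εW hDV0 hDW0 hcV hcW htV htW v')
      (archToAdelic_archSingle_prod_one E c N M hc wOf hfix v u)).trans
    (archPairPlace_adelicSingle_one_of_ne E c N M hc wOf hw hover tV tW hJV hJW εV εW hDV0 hDW0 hcV hcW htV htW hfix v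
      h u)

end Section

/-! ## §3 The vacuum exponent at a definite place, on every test vector that is the vacuum there -/

section Definite

variable {F : Type} [Field F] [NumberField F] (E : Type) [Field E] [NumberField E] [Algebra F E] (c : E ≃ₐ[F] E)
variable (N M : ℕ) (hc : c ≠ 1)
  (wOf : {v : InfinitePlace F // v.IsReal} → {w : InfinitePlace E // w.IsComplex})
  (hw : ∀ v, c • (wOf v).1 = (wOf v).1) (hover : ∀ v, (wOf v).1.comap (algebraMap F E) = v.1)
  (tV : Fin N → F) (tW : Fin M → F) {JV : Matrix (Fin N) (Fin N) E} {JW : Matrix (Fin M) (Fin M) E}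
  (hJV : JV = (Matrix.diagonal tV).map (algebraMap F E)) (hJW : JW = (Matrix.diagonal tW).map (algebraMap F E))
  {P Q R S : {v : InfinitePlace F // v.IsReal} → Type*} [∀ v, Fintype (P v)] [∀ v, DecidableEq (P v)]
  [∀ v, Fintype (Q v)] [∀ v, DecidableEq (Q v)] [∀ v, Fintype (R v)] [∀ v, DecidableEq (R v)]
  [∀ v, Fintype (S v)] [∀ v, DecidableEq (S v)]
  (εV : ∀ v, Fin N ≃ P v ⊕ Q v) (εW : ∀ v, Fin M ≃ R v ⊕ S v)
  {DV : {v : InfinitePlace F // v.IsReal} → Fin N → ℝ} {DW : {v : InfinitePlace F // v.IsReal} → Fin M → ℝ}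
  (hDV0 : ∀ v i, DV v i ≠ 0) (hDW0 : ∀ v j, DW v j ≠ 0) {cV cW : {v : InfinitePlace F // v.IsReal} → ℝ}
  (hcV : ∀ v, cV v ≠ 0) (hcW : ∀ v, cW v ≠ 0)
  (htV : ∀ v i, embedding_of_isReal v.2 (tV i) = cV v * signOf (εV v i) * DV v i ^ 2)
  (htW : ∀ v j, embedding_of_isReal v.2 (tW j) = cW v * signOf (εW v j) * DW v j ^ 2)
  (hfix : ∀ w : InfinitePlace E, c • w = w) (v : {v : InfinitePlace F // v.IsReal})
  {ι : Type} [Fintype ι] [DecidableEq ι]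

/-- **THE VACUUM EXPONENT AT A DEFINITE PLACE ON ALL TEST VECTORS THAT ARE THE VACUUM THERE.**  For an archimedean
Weil datum `ω` of the archimedean pair group `U(J_V)(E ⊗ ℝ) × U(J_W)(E ⊗ ℝ)` on `𝓢(ℝ^{ι × {v real}})` over the
place-by-place junctions `ι𝕎 (P v) (Q v) (R v) (S v)` read through weil-2's frames (`ϖ u v = archPairPlace v (u₁, u₂)`),
and a real place `v` where `V` is definite (`P v` or `Q v` empty): ONE integer `m` with
`ω (archSingle (wOf v) u, 1) (B⁻¹G) = det(u)^m • B⁻¹G` for every `u ∈ U(σ_{w(v)} J_V)(ℂ)` and every Fock polynomial `G`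
free of the place `v`, and `ω (archSingle (wOf v) u, 1) h₀ = det(u)^m • h₀`.
[cite: KonnoKonno2007, §3.1 (3.1); Folland1989, Prop (4.39); BorelJacquet1979, §4.1] -/
theorem exists_forall_archSingle_binvPi_eq_det_zpow_smul (ε : ∀ v, ι ≃ DPIdx (P v) (Q v) (R v) (S v))
    (ϖ : UnitaryGroup.arch F E c N JV × UnitaryGroup.arch F E c M JW →* ∀ v, Ginf (P v) (Q v) (R v) (S v))
    (hϖ : ∀ u v', ϖ u v' = archPairPlace E c N M hc wOf hw hover tV tW hJV hJW εV εW hDV0 hDW0 hcV hcW htV htW v'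
        (UnitaryGroup.archToAdelic F E c N JV u.1, UnitaryGroup.archToAdelic F E c M JW u.2))
    {ω : Representation ℂ (UnitaryGroup.arch F E c N JV × UnitaryGroup.arch F E c M JW)
      (SchwartzMap (ι × {v : InfinitePlace F // v.IsReal} → ℝ) ℂ)}
    (hW : IsArchWeilDatum ((piPhaseHom ε fun v => ι𝕎 (P v) (Q v) (R v) (S v)).comp ϖ) ω)
    (hVdef : IsEmpty (P v) ∨ IsEmpty (Q v)) :
    ∃ m : ℤ,
      (∀ u : archLocal E N JV (wOf v),
        ω (archSingle F E c N JV hc hfix (wOf v) u, 1) (hermitePi 0) =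
          ((((u : archLocal E N JV (wOf v)) : GL (Fin N) ℂ) : Matrix (Fin N) (Fin N) ℂ).det ^ m) • hermitePi 0) ∧
      ∀ (u : archLocal E N JV (wOf v)) (G : MvPolynomial (ι × {v : InfinitePlace F // v.IsReal}) ℂ),
        (∀ x ∈ G.vars, x.2 ≠ v) →
          ω (archSingle F E c N JV hc hfix (wOf v) u, 1) (binvPi G) =
            ((((u : archLocal E N JV (wOf v)) : GL (Fin N) ℂ) : Matrix (Fin N) (Fin N) ℂ).det ^ m) • binvPi G := by
  -- the frame isomorphism at `v` and the continuous section `g ↦ (archSingle (wOf v) (eT⁻¹ g), 1)`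
  let eT : archLocal E N JV (wOf v) ≃ₜ* UForm (P v) (Q v) := toUFormEquiv (εV v) (hDV0 v) (hcV v)
    ((formCongr_scaleGL_smul_signForm (εV v) (hDV0 v) (cV v) (htV v)).trans
      (archLocalForm_diagonal E c N hc wOf hw hover tV hJV v).symm)
  have heT_symm : ∀ g : UForm (P v) (Q v),
      toUForm (εV v) (hDV0 v) (hcV v) ((formCongr_scaleGL_smul_signForm (εV v) (hDV0 v) (cV v) (htV v)).trans
        (archLocalForm_diagonal E c N hc wOf hw hover tV hJV v).symm) (eT.symm g) = g :=
    fun g => toUForm_toUFormEquiv_symm _ _ _ _ g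
  have hdet : ∀ u : archLocal E N JV (wOf v),
      ((((eT u : UForm (P v) (Q v)) : GL (P v ⊕ Q v) ℂ) : Matrix (P v ⊕ Q v) (P v ⊕ Q v) ℂ)).det =
        (((u : archLocal E N JV (wOf v)) : GL (Fin N) ℂ) : Matrix (Fin N) (Fin N) ℂ).det :=
    fun u => det_coe_toUForm (εV v) (hDV0 v) (hcV v) ((formCongr_scaleGL_smul_signForm (εV v) (hDV0 v) (cV v) (htV v)).trans
      (archLocalForm_diagonal E c N hc wOf hw hover tV hJV v).symm) u
  let sec : UForm (P v) (Q v) →* UnitaryGroup.arch F E c N JV × UnitaryGroup.arch F E c M JW :=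
    ((archSingle F E c N JV hc hfix (wOf v)).comp eT.symm.toMulEquiv.toMonoidHom).prod 1
  have hsec_apply : ∀ g, sec g = (archSingle F E c N JV hc hfix (wOf v) (eT.symm g), 1) := fun _ => rfl
  have hsec : Continuous sec :=
    (((continuous_archSingle F E c N JV hc hfix (wOf v)).comp eT.symm.continuous).prodMk continuous_const).congr
      fun g => (hsec_apply g).symm
  have hϖsec : ∀ g, ϖ (sec g) = Pi.mulSingle v ((g, 1) : Ginf (P v) (Q v) (R v) (S v)) := by
    intro g
    funext v'
    rw [hϖ, hsec_apply]
    by_cases hv' : v' = v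
    · rw [hv', Pi.mulSingle_eq_same]
      exact (archPairPlace_archSingle_one_self E c N M hc wOf hw hover tV tW hJV hJW εV εW hDV0 hDW0 hcV hcW htV htW
        hfix v (eT.symm g)).trans (Prod.ext (heT_symm g) rfl)
    · rw [Pi.mulSingle_eq_of_ne hv']
      exact archPairPlace_archSingle_one_of_ne E c N M hc wOf hw hover tV tW hJV hJW εV εW hDV0 hDW0 hcV hcW htV htW
        hfix v hv' (eT.symm g)
  obtain ⟨m, h0, hG⟩ := hW.exists_forall_place_binvPi_eq_det_zpow_smul ε ϖ v hVdef sec hsec hϖsec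
  have hsecT : ∀ u : archLocal E N JV (wOf v), sec (eT u) = (archSingle F E c N JV hc hfix (wOf v) u, 1) := fun u => by
    rw [hsec_apply, ContinuousMulEquiv.symm_apply_apply]
  refine ⟨m, fun u => ?_, fun u G hGv => ?_⟩
  · have h1 := h0 (eT u)
    rwa [hsecT, hdet] at h1
  · have h1 := hG (eT u) G hGv
    rwa [hsecT, hdet] at h1

end Definite

/-! ## §4 The transported form (a representation on `𝓢(D)` read through `repTransport e`) -/

section Transported

variable {F : Type} [Field F] [NumberField F] (E : Type) [Field E] [NumberField E] [Algebra F E] (c : E ≃ₐ[F] E)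
variable (N M : ℕ) (hc : c ≠ 1)
  (wOf : {v : InfinitePlace F // v.IsReal} → {w : InfinitePlace E // w.IsComplex})
  (hw : ∀ v, c • (wOf v).1 = (wOf v).1) (hover : ∀ v, (wOf v).1.comap (algebraMap F E) = v.1)
  (tV : Fin N → F) (tW : Fin M → F) {JV : Matrix (Fin N) (Fin N) E} {JW : Matrix (Fin M) (Fin M) E}
  (hJV : JV = (Matrix.diagonal tV).map (algebraMap F E)) (hJW : JW = (Matrix.diagonal tW).map (algebraMap F E))
  {P Q R S : {v : InfinitePlace F // v.IsReal} → Type*} [∀ v, Fintype (P v)] [∀ v, DecidableEq (P v)]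
  [∀ v, Fintype (Q v)] [∀ v, DecidableEq (Q v)] [∀ v, Fintype (R v)] [∀ v, DecidableEq (R v)]
  [∀ v, Fintype (S v)] [∀ v, DecidableEq (S v)]
  (εV : ∀ v, Fin N ≃ P v ⊕ Q v) (εW : ∀ v, Fin M ≃ R v ⊕ S v)
  {DV : {v : InfinitePlace F // v.IsReal} → Fin N → ℝ} {DW : {v : InfinitePlace F // v.IsReal} → Fin M → ℝ}
  (hDV0 : ∀ v i, DV v i ≠ 0) (hDW0 : ∀ v j, DW v j ≠ 0) {cV cW : {v : InfinitePlace F // v.IsReal} → ℝ}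
  (hcV : ∀ v, cV v ≠ 0) (hcW : ∀ v, cW v ≠ 0)
  (htV : ∀ v i, embedding_of_isReal v.2 (tV i) = cV v * signOf (εV v i) * DV v i ^ 2)
  (htW : ∀ v j, embedding_of_isReal v.2 (tW j) = cW v * signOf (εW v j) * DW v j ^ 2)
  (hfix : ∀ w : InfinitePlace E, c • w = w) (v : {v : InfinitePlace F // v.IsReal})
  {ι : Type} [Fintype ι] [DecidableEq ι]
  {D : Type*} [NormedAddCommGroup D] [NormedSpace ℝ D]

/-- **Transported form.**  If the datum is `repTransport e ρ` for a representation `ρ` on `𝓢(D)` and a real frame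
`e : D ≃L ℝ^{ι × {v real}}` (the census kit's `(J-arch)` datum is of this shape, `ρ = archWeilRep …`, `e = e_D` the
scaled Folland frame), then at a definite place `v`: ONE integer `m` with
`ρ (archSingle (wOf v) u, 1) Φ = det(u)^m • Φ` for every `u ∈ U(σ_{w(v)} J_V)(ℂ)` and every `Φ ∈ 𝓢(D)` whose frame image
`schwartzTransport e Φ = B⁻¹G` has `G` free of the place `v`. [cite: KonnoKonno2007, §3.1 (3.1); Folland1989, Prop (4.39)] -/
theorem exists_forall_archSingle_eq_det_zpow_smul_of_repTransport (e : D ≃L[ℝ] (ι × {v : InfinitePlace F // v.IsReal} → ℝ))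
    (ε : ∀ v, ι ≃ DPIdx (P v) (Q v) (R v) (S v))
    (ϖ : UnitaryGroup.arch F E c N JV × UnitaryGroup.arch F E c M JW →* ∀ v, Ginf (P v) (Q v) (R v) (S v))
    (hϖ : ∀ u v', ϖ u v' = archPairPlace E c N M hc wOf hw hover tV tW hJV hJW εV εW hDV0 hDW0 hcV hcW htV htW v'
        (UnitaryGroup.archToAdelic F E c N JV u.1, UnitaryGroup.archToAdelic F E c M JW u.2))
    {ρ : Representation ℂ (UnitaryGroup.arch F E c N JV × UnitaryGroup.arch F E c M JW) (SchwartzMap D ℂ)}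
    (hW : IsArchWeilDatum ((piPhaseHom ε fun v => ι𝕎 (P v) (Q v) (R v) (S v)).comp ϖ) (repTransport e ρ))
    (hVdef : IsEmpty (P v) ∨ IsEmpty (Q v)) :
    ∃ m : ℤ, ∀ (u : archLocal E N JV (wOf v)) (G : MvPolynomial (ι × {v : InfinitePlace F // v.IsReal}) ℂ),
      (∀ x ∈ G.vars, x.2 ≠ v) → ∀ Φ : SchwartzMap D ℂ, schwartzTransport e Φ = binvPi G →
        ρ (archSingle F E c N JV hc hfix (wOf v) u, 1) Φ =
          ((((u : archLocal E N JV (wOf v)) : GL (Fin N) ℂ) : Matrix (Fin N) (Fin N) ℂ).det ^ m) • Φ := by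
  obtain ⟨m, -, hG⟩ := exists_forall_archSingle_binvPi_eq_det_zpow_smul E c N M hc wOf hw hover tV tW hJV hJW εV εW hDV0
    hDW0 hcV hcW htV htW hfix v ε ϖ hϖ hW hVdef
  refine ⟨m, fun u G hGv Φ hΦ => ?_⟩
  have h1 := hG u G hGv
  rw [repTransport_apply, ← hΦ, ContinuousLinearEquiv.symm_apply_apply, ← map_smul] at h1
  exact (schwartzTransport e).injective h1

end Transported

end Literature.NumberTheory.Weil1964

end
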